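import Mathlib
import Literature.NumberTheory.Transcendental.KZCalculus
import Literature.NumberTheory.Transcendental.MZVSimplexRep
import Literature.NumberTheory.Transcendental.GenusZeroPeriodsMZVProofs

/-!
# `TateLifting` (stmt-KontsevichZagierPeriods-9129), line `Sketch` — stub `stub_simplexValue`

SIMPLEX VOLUMES (stub 61, the body of `SimplexValue`). For every real `n × n` matrix `A`, every
vector `b ∈ ℝⁿ` and every integral representation `r` whose domain is the affine image
`A(Δ_n) + b` of the open ordered simplex
`Δ_n = KZ.openOrderedSimplex n = {1 > t₀ > t₁ > ⋯ > t_{n-1} > 0}` and whose integrand is `1` on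
that domain, the represented number is `|det A| / n!`:

* `r.value = ∫_{r.domain} 1 = vol(r.domain)` (`setIntegral_congr_fun`, `setIntegral_const`);
* `vol(A(Δ_n) + b) = vol(A(Δ_n)) = |det A| · vol(Δ_n)` — translation invariance of Lebesgue
  measure and `Measure.addHaar_image_linearMap`, valid for EVERY linear map (a singular `A`
  squeezes `Δ_n` into a proper subspace, of measure `0 = |0| · vol Δ_n`), so no hypothesis
  `det A ≠ 0` is needed;
* `vol(Δ_n) = 1/n!` through Brown's cubical chart `Φ(x)_i = x₀ ⋯ x_i` of the simplex
  (`Hyperlog.integral_simplex_eq_integral_cube`): `∫_{Δ_n} 1 = ∫_{(0,1)ⁿ} det Φ'(x) dx` with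
  `det Φ'(x) = ∏_i ∏_{k<i} x_k = ∏_k x_k^{n-1-k}` (`Hyperlog.det_φc'`), and by Fubini
  `∫_{(0,1)ⁿ} ∏_k x_k^{n-1-k} dx = ∏_k 1/(n-k) = 1/n!`.

References: M. Kontsevich, D. Zagier, *Periods* (2001), §1.1; F. Brown, *Multiple zeta values and
periods of moduli spaces 𝔐̄_{0,n}*, Ann. Sci. ÉNS 42 (2009), §2.2 (cubical coordinates).
-/

noncomputable section

open MeasureTheory Set
open Literature.NumberTheory.Transcendental

namespace Summit.KontsevichZagierPeriods.InverseLandau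

namespace SimplexValue

/-- Rearrangement of the Jacobian of the cubical chart: `∏_i ∏_{k<i} x_k = ∏_k x_k^{n-1-k}`
(the factor `x_k` occurs once for every `i > k`, i.e. `#(Ioi k) = n - 1 - k` times). [folklore] -/
theorem prod_prod_Iio_eq_prod_pow {n : ℕ} (x : Fin n → ℝ) :
    (∏ i : Fin n, ∏ k ∈ Finset.Iio i, x k) = ∏ k : Fin n, x k ^ (n - 1 - (k : ℕ)) := by
  rw [Finset.prod_comm' (t' := Finset.univ) (s' := fun k => Finset.Ioi k)]
  · refine Finset.prod_congr rfl fun k _ => ?_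
    rw [Finset.prod_const, Fin.card_Ioi]
  · intro i k
    simp only [Finset.mem_univ, true_and, and_true, Finset.mem_Iio, Finset.mem_Ioi]

/-- Fubini on the open unit cube for the monomial `∏_k x_k^{n-1-k}`:
`∫_{(0,1)ⁿ} ∏_k x_k^{n-1-k} dx = ∏_k ∫₀¹ t^{n-1-k} dt = ∏_k 1/((n-1-k)+1)`. [folklore] -/
theorem integral_cube_prod_pow (n : ℕ) :
    ∫ x in Hyperlog.cube n, ∏ k : Fin n, x k ^ (n - 1 - (k : ℕ)) =
      ∏ k : Fin n, 1 / (((n - 1 - (k : ℕ) : ℕ) : ℝ) + 1) := by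
  rw [Hyperlog.cube_eq_pi, volume_pi, Measure.restrict_pi_pi,
    integral_fintype_prod_eq_prod (𝕜 := ℝ) (fun (k : Fin n) (t : ℝ) => t ^ (n - 1 - (k : ℕ)))]
  refine Finset.prod_congr rfl fun k _ => ?_
  rw [← integral_Ioc_eq_integral_Ioo, ← intervalIntegral.integral_of_le zero_le_one, integral_pow]
  simp

/-- The telescoping product `∏_{k<n} 1/((n-1-k)+1) = ∏_{j<n} 1/(j+1) = 1/n!`. [folklore] -/
theorem prod_one_div_eq_one_div_factorial (n : ℕ) :
    ∏ k : Fin n, 1 / (((n - 1 - (k : ℕ) : ℕ) : ℝ) + 1) = 1 / (n.factorial : ℝ) := by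
  rw [Fin.prod_univ_eq_prod_range (fun k => 1 / (((n - 1 - k : ℕ) : ℝ) + 1)) n]
  have h₁ : (∏ j ∈ Finset.range n, 1 / (((n - 1 - j : ℕ) : ℝ) + 1)) =
      ∏ j ∈ Finset.range n, 1 / ((j : ℝ) + 1) :=
    Finset.prod_range_reflect (fun j => 1 / ((j : ℝ) + 1)) n
  have h₂ : ∏ j ∈ Finset.range n, ((j : ℝ) + 1) = (n.factorial : ℝ) := by
    rw [← Finset.prod_range_add_one_eq_factorial, Nat.cast_prod]
    push_cast
    rfl
  rw [h₁, Finset.prod_div_distrib, Finset.prod_const_one, h₂]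

/-- **The volume of the open ordered simplex**: `vol {1 > t₀ > ⋯ > t_{n-1} > 0} = 1/n!`, computed
through Brown's cubical chart (`∫_{Δ_n} 1 = ∫_{(0,1)ⁿ} det Φ' = ∫_{(0,1)ⁿ} ∏_k x_k^{n-1-k} = 1/n!`).
[folklore] -/
theorem volume_real_openOrderedSimplex (n : ℕ) :
    volume.real (KZ.openOrderedSimplex n) = 1 / (n.factorial : ℝ) := by
  have h : ∫ _ in KZ.openOrderedSimplex n, (1 : ℝ) = volume.real (KZ.openOrderedSimplex n) := by
    rw [setIntegral_const, smul_eq_mul, mul_one]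
  rw [← h, Hyperlog.integral_simplex_eq_integral_cube]
  simp_rw [mul_one, Hyperlog.det_φc', prod_prod_Iio_eq_prod_pow]
  rw [integral_cube_prod_pow, prod_one_div_eq_one_div_factorial]

/-- **Affine images of the simplex**: `vol(A(Δ_n) + b) = |det A| · vol(Δ_n)` for EVERY square
matrix `A` (translation invariance and `Measure.addHaar_image_linearMap`; for singular `A` both
sides vanish). [folklore] -/
theorem volume_image_affine_openOrderedSimplex {n : ℕ} (A : Matrix (Fin n) (Fin n) ℝ)
    (b : Fin n → ℝ) :
    volume ((fun x => A.mulVec x + b) '' KZ.openOrderedSimplex n) =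
      ENNReal.ofReal |A.det| * volume (KZ.openOrderedSimplex n) := by
  have himg : (fun x => A.mulVec x + b) '' KZ.openOrderedSimplex n =
      (fun y => y + b) '' (Matrix.toLin' A '' KZ.openOrderedSimplex n) := by
    rw [Set.image_image]
    simp only [Matrix.toLin'_apply]
  rw [himg, Set.image_add_right, measure_preimage_add_right, Measure.addHaar_image_linearMap,
    LinearMap.det_toLin']

end SimplexValue

open SimplexValue in
/-- **Simplex volumes** (stub `stub_simplexValue` of line `Sketch` for crux `TateLifting`): the
integrand-`1` representation over the affine image `A(Δ_n) + b` of the open ordered simplex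
`Δ_n = {1 > t₀ > ⋯ > t_{n-1} > 0}` has value `|det A| / n!` — for every square matrix `A`
(singular ones included: then the domain is null and both sides vanish). [folklore] -/
theorem tateLifting_simplexValue :
  ∀ (n : ℕ) (A : Matrix (Fin n) (Fin n) ℝ) (b : Fin n → ℝ) (r : KZ.IntegralRep n),
    r.domain = (fun x => A.mulVec x + b) '' KZ.openOrderedSimplex n → (∀ y ∈ r.domain, r.integrand y = 1) →
    r.value = |A.det| / n.factorial := by
  intro n A b r hdom hri
  rw [KZ.IntegralRep.value, setIntegral_congr_fun (KZ.IntegralRep.measurableSet_domain_holds r) hri,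
    setIntegral_const, smul_eq_mul, mul_one, measureReal_def, hdom,
    volume_image_affine_openOrderedSimplex, ENNReal.toReal_mul, ENNReal.toReal_ofReal (abs_nonneg _),
    ← measureReal_def, volume_real_openOrderedSimplex, mul_one_div]

end Summit.KontsevichZagierPeriods.InverseLandau
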